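import Summits.ABC.IUTFork.Joshi.AdelicAnsatz
import Mathlib.Topology.MetricSpace.PiNat

/-!
# [J-III] §4.1–4.2, companion: derived theorems for `Joshi/AdelicAnsatz.lean`

Block E, seat abc-iut-E-t7, slot T-07 (inventory `HOME/plan/E/t7/INVENTORY.tsv`). TAKES NO SIDE on [IUTchIII]
Cor. 3.12, on Joshi's claims, or on Mochizuki's reports on them; typed ≠ proved. PROOF-ONLY companion of the
typing file `Joshi/AdelicAnsatz.lean` (K. Joshi, arXiv:2401.13508v4 = `paper:arxiv-2401.13508`, render
`HOME/lit/renders/Joshi-arxiv-2401.13508/pNNNN.txt`; [J-2½] = arXiv:2305.10398; [J-2p] = arXiv:2303.01662v3): nothing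
new is claimed; every theorem is DERIVED from the typed signature `AdelicCurveDatum` and the INPUT hypothesis
`Prop`s of that file.

CONTENTS. §0 two elementary lemmas on integer powers of permutations; §1 the `ϕ^ℤ`-form of Thm. 4.2.2.1 (2)
(Def. 4.2.1 (2): the GROUP `ϕ^ℤ` acts) and Thm. 4.2.2.1 (2) derived from [J-2p] Prop. 6.6.1; Thm. 4.2.2.1 (3) derived
IN THE DIAGONAL READING from [J-2½] Thm. 4.2.3 (4) (READING QUESTION of the typing file: the literal, twisted
reading `AnsatzLStarStable` is typed there and NOT derived); §2 Cor. 4.2.2.4 (prose; the exponent bookkeeping it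
refers to); §3 [J-2½] Lem. 4.1.2 (countable product of metrisable factors, from Mathlib's `PiCountable.metricSpace`)
and Rmk. 4.2.3.4; §4 a one-point model of the signature (joint satisfiability of its equational fields only — no
mathematical content).
-/

noncomputable section

open TopologicalSpace

namespace Summit.ABC.IUTFork.Joshi

/-! ## 0. Two generic lemmas on integer powers of permutations -/

namespace AdelicAnsatzAux

/-- A map `f` intertwining the permutations `e` and `e'` (`f ∘ e = e' ∘ f`) intertwines all their integer
powers. (Elementary; used for «the forgetful map (4.2.1.2) commutes with Frobenius».) -/
theorem semiconj_zpow {α β : Type} (f : α → β) (e : Equiv.Perm α) (e' : Equiv.Perm β)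
    (h : ∀ x, f (e x) = e' (f x)) (n : ℤ) (x : α) : f ((e ^ n) x) = (e' ^ n) (f x) := by
  have hinv : ∀ y, f (e⁻¹ y) = e'⁻¹ (f y) := fun y =>
    Equiv.Perm.eq_inv_iff_eq.mpr (by rw [← h]; simp)
  induction n generalizing x with
  | zero => simp
  | succ i ih => simp only [zpow_add_one, Equiv.Perm.mul_apply, ih, h]
  | pred i ih => simp only [zpow_sub_one, Equiv.Perm.mul_apply, ih, hinv]

/-- A set of `ι`-tuples invariant (as an `↔`) under the componentwise action of a permutation `e` is invariant
under the componentwise action of every integer power of `e`. (Elementary; used for `ϕ^ℤ`-stability.) -/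
theorem mem_iff_zpow_mem {ι α : Type} (A : Set (ι → α)) (e : Equiv.Perm α)
    (h : ∀ t : ι → α, t ∈ A ↔ (fun i => e (t i)) ∈ A) (n : ℤ) (t : ι → α) :
    t ∈ A ↔ (fun i => (e ^ n) (t i)) ∈ A := by
  have hinv : ∀ t : ι → α, t ∈ A ↔ (fun i => e⁻¹ (t i)) ∈ A := fun t => by
    rw [h (fun i => e⁻¹ (t i))]; simp
  induction n generalizing t with
  | zero => simp
  | succ i ih =>
      refine (h t).trans ((ih fun k => e (t k)).trans ?_)
      simp only [zpow_add_one, Equiv.Perm.mul_apply]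
  | pred i ih =>
      refine (hinv t).trans ((ih fun k => e⁻¹ (t k)).trans ?_)
      simp only [zpow_sub_one, Equiv.Perm.mul_apply]

end AdelicAnsatzAux

namespace AdelicCurveDatum

variable (D : AdelicCurveDatum)

/-! ## 1. Thm. 4.2.2.1 (2) in `ϕ^ℤ`-form and derived; Thm. 4.2.2.1 (3) derived in the diagonal reading -/

/-- `Σ̃_{L′}` is invariant (as an `↔`) under every integer power of the diagonal Frobenius, given the input [J-2p]
Prop. 6.6.1: the `ϕ^ℤ`-form of Thm. 4.2.2.1 (2) (Def. 4.2.1 (2)). [claim: Joshi2024ATS3, status: disputed] -/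
theorem mem_adelicAnsatz_iff_frobTuple_zpow_mem (h : D.PrimAnsatzFrobeniusInvariant) (n : ℤ) (z : D.Tuple) :
    z ∈ D.adelicAnsatz ↔ (D.frobTuple ^ n) z ∈ D.adelicAnsatz := by
  -- the `(j, w)`-entry of `ϕ^n · z` is `ϕ_w^n (y_{j,w})`
  have hentry : ∀ (j : Fin D.lstar) (w : D.V), (D.frobTuple ^ n) z j w = (D.frob w ^ n) (z j w) := by
    intro j w
    have h1 := AdelicAnsatzAux.semiconj_zpow (fun t : D.Tuple => t j) D.frobTuple
      (Equiv.piCongrRight D.frob) (fun _ => rfl) n z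
    have h2 := AdelicAnsatzAux.semiconj_zpow (fun y : D.Curve => y w) (Equiv.piCongrRight D.frob) (D.frob w)
      (fun _ => rfl) n (z j)
    exact (congrFun h1 w).trans h2
  have hfg : ∀ (w : D.V) (y : D.Y w), D.forget w ((D.frob w ^ n) y) = (D.frob0 (D.pOf w) ^ n) (D.forget w y) :=
    fun w => AdelicAnsatzAux.semiconj_zpow (D.forget w) (D.frob w) (D.frob0 (D.pOf w)) (D.forget_frob w) n
  refine ⟨fun hz => ⟨fun w hw j => ?_, fun w hw => ?_⟩, fun hz => ⟨fun w hw j => ?_, fun w hw => ?_⟩⟩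
  · rw [hentry, hentry, hz.1 w hw j]
  · show (fun j => D.forget w ((D.frobTuple ^ n) z j w)) ∈ D.primAnsatz (D.pOf w)
    simp_rw [hentry, hfg]
    exact (AdelicAnsatzAux.mem_iff_zpow_mem _ _ (h (D.pOf w)) n _).1 (hz.2 w hw)
  · have := hz.1 w hw j
    rw [hentry, hentry] at this
    exact (D.frob w ^ n).injective this
  · have hmem := hz.2 w hw
    change (fun j => D.forget w ((D.frobTuple ^ n) z j w)) ∈ D.primAnsatz (D.pOf w) at hmem
    simp_rw [hentry, hfg] at hmem
    exact (AdelicAnsatzAux.mem_iff_zpow_mem _ _ (h (D.pOf w)) n _).2 hmem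

/-- **Thm. 4.2.2.1 (2) DERIVED** from the input [J-2p] Prop. 6.6.1 (Joshi's proof, p.33 l.46–47).
[claim: Joshi2024ATS3, status: disputed] -/
theorem ansatzFrobeniusStable_of (h : D.PrimAnsatzFrobeniusInvariant) : D.AnsatzFrobeniusStable :=
  fun z hz => by simpa using (D.mem_adelicAnsatz_iff_frobTuple_zpow_mem h 1 z).1 hz

/-- **Thm. 4.2.2.1 (3) DERIVED IN THE DIAGONAL READING** — the «Hence» of p.33 l.1: at `w ∈ V^{odd,ss}` an `x ∈ L′*`
acts through `ϕ_w^n`, `n ∈ ℤ` ([J-2½] Thm. 4.2.3 (4)), under which the local Ansatz is invariant ([J-2p]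
Prop. 6.6.1 transported along (4.2.1.2)); at the other places any factorwise map preserves the diagonal condition.
[claim: Joshi2024ATS3, status: disputed] -/
theorem ansatzLStarStableDiag_of (hF : D.LStarThroughFrobenius) (h : D.PrimAnsatzFrobeniusInvariant) :
    D.AnsatzLStarStableDiag := by
  intro x z hz
  refine ⟨fun w hw j => ?_, fun w hw => ?_⟩
  · show D.lact x w (z j w) = D.lact x w (z D.jOne w)
    rw [hz.1 w hw j]
  · obtain ⟨n, hn⟩ := hF w hw x
    have hfg : ∀ y : D.Y w, D.forget w ((D.frob w ^ n) y) = (D.frob0 (D.pOf w) ^ n) (D.forget w y) :=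
      AdelicAnsatzAux.semiconj_zpow (D.forget w) (D.frob w) (D.frob0 (D.pOf w)) (D.forget_frob w) n
    show (fun j => D.forget w (D.lact x w (z j w))) ∈ D.primAnsatz (D.pOf w)
    simp_rw [hn, hfg]
    exact (AdelicAnsatzAux.mem_iff_zpow_mem _ _ (h (D.pOf w)) n _).1 (hz.2 w hw)

/-! ## 2. Cor. 4.2.2.4 (prose) and the exponent bookkeeping it refers to -/

/-- **Cor. 4.2.2.4** (READING, prose; docstring only), p.33 l.81 – p.34 l.11: «Suppose that the notations and
assumptions of Theorem 4.2.2.1 remain in force. Then the non-trivial scaling relationship established by Theorem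
4.2.2.1(3) [the valuation scaling, (4) in the statement's numbering] at primes `w ∈ V^{odd,ss}`, forces that suitable
(re)normalization of valuations must be introduced at primes `w ∈ 𝕍_{L′} − V^{odd,ss}` so that the product formula
continues to hold for each normalized arithmeticoid `arith(L)^{nor}_{y′_j}` given by `(y′₁, …, y′_{ℓ*})`. Proof. This
is clear from Theorem 4.2.2.1 and the global constraint placed by the requirement that the product formula holds.»
Attribution sentence p.33 l.79–80: «Mochizuki asserts the content of the next corollary as [Mochizuki, 2021a,
Theorem A(ii)]». Not typed: normalised arithmeticoids and their product formula are [J-2½] §5 vocabulary (no block-E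
file yet). What IS recorded is the exponent bookkeeping the corollary refers to: the family of scaling exponents
`e(w, j)` of Thm. 4.2.2.1 (4)/(5). [claim: Joshi2024ATS3, status: disputed] -/
def scalingExponent (w : D.V) (j : Fin D.lstar) : ℕ := by
  classical exact if w ∈ D.oddss then D.printedIndex j ^ 2 else 1

/-- The exponent family is «non-trivial» in Cor. 4.2.2.4's sense: at `j = ℓ*` it takes the value `ℓ*²` on
`V^{odd,ss}` and `1` off it, and these differ as soon as `ℓ* ≥ 2` (i.e. `ℓ ≥ 5`). Elementary bookkeeping only. -/
theorem scalingExponent_jLast_ne (hl : 2 ≤ D.lstar) {w w' : D.V} (hw : w ∈ D.oddss) (hw' : w' ∉ D.oddss) :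
    D.scalingExponent w D.jLast ≠ D.scalingExponent w' D.jLast := by
  classical
  simp only [scalingExponent, if_pos hw, if_neg hw', printedIndex_jLast]
  intro h
  have : D.lstar ^ 2 ≥ 2 ^ 2 := Nat.pow_le_pow_left hl 2
  omega

/-! ## 3. [J-2½] Lem. 4.1.2 and Rmk. 4.2.3.4 -/

/-- **[J-2½] Lem. 4.1.2 DERIVED** (p.20 l.72–91: «The set `𝕍_L` is countable … countable products of metric spaces
and hence the product topology can be given by a metric»): if `𝕍_{L′}` is countable and every factor
`|Y_{C_p^♭,L′_w}|` is metrisable ([FF18 Prop. 2.3.2] for non-archimedean `w`), then `𝒴′_{L′}` is metrisable in the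
product topology (Mathlib's `PiCountable.metricSpace`, whose uniformity is the product uniformity). -/
theorem curve_metrizable_of_countable [Countable D.V] [∀ w, TopologicalSpace (D.Y w)]
    [∀ w, MetrizableSpace (D.Y w)] : MetrizableSpace D.Curve := by
  letI : ∀ w, MetricSpace (D.Y w) := fun w => TopologicalSpace.metrizableSpaceMetric (D.Y w)
  letI : Encodable D.V := Encodable.ofCountable D.V
  letI : MetricSpace D.Curve := PiCountable.metricSpace
  infer_instance

/-- **Rmk. 4.2.3.4**, p.34 l.55–56: «for a choice of a metric on `𝒴_{L′}`, it makes sense to talk about the distance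
between two distinct `Θgau`-Links» — the type of `Θgau`-Links, topologised through `thetaGauLinkEquiv`, is
metrisable whenever `Σ̃_{L′}` is. [claim: Joshi2024ATS3, status: disputed] -/
theorem thetaGauLink_metrizable [∀ w, TopologicalSpace (D.Y w)] [MetrizableSpace D.Curve] :
    @MetrizableSpace D.ThetaGauLink (TopologicalSpace.induced D.thetaGauLinkEquiv inferInstance) := by
  haveI : MetrizableSpace D.adelicAnsatz := D.ansatzMetrisable_of
  letI : TopologicalSpace D.ThetaGauLink := TopologicalSpace.induced D.thetaGauLinkEquiv inferInstance
  exact (Topology.IsEmbedding.induced D.thetaGauLinkEquiv.injective).metrizableSpace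

end AdelicCurveDatum

/-! ## 4. A one-point model of the signature (joint satisfiability of the equational fields only) -/

/-- The signature `AdelicCurveDatum` is inhabited: a one-point model with `ℓ* = 2` (all carriers `Unit`, all maps
trivial, primitive ansatz = everything). NO mathematical content — it only certifies that the equational fields
`forget_gal`, `forget_frob`, `lact_lpow`, `forget_abs` are jointly satisfiable, so that hypotheses over the signature
are not vacuously uninhabited. -/
def AdelicCurveDatum.trivialModel : AdelicCurveDatum where
  V := Unit
  oddss := Set.univ
  P := Unit
  pOf _ := ()
  Y _ := Unit
  Y0 _ := Unit
  forget _ _ := ()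
  lstar := 2
  one_le_lstar := by decide
  G _ := Unit
  gact _ _ _ := ()
  G0 _ := Unit
  g0act _ _ _ := ()
  res _ _ := ()
  forget_gal _ _ _ := rfl
  frob _ := Equiv.refl Unit
  frob0 _ := Equiv.refl Unit
  forget_frob _ _ := rfl
  Lstar := Unit
  lpow _ _ := ()
  lact _ _ _ := ()
  lact_lpow _ _ _ _ := Subsingleton.elim _ _
  T _ := Unit
  absK _ _ _ := 1
  absK0 _ _ _ := 1
  forget_abs _ _ := rfl
  primAnsatz _ := Set.univ

/-- In the one-point model every `ℓ*`-tuple lies in the Adelic Ansatz (so the typed claims are not about an empty set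
there) and all four inputs hold; e.g. the valuation scaling `1 = 1^{j²}`. -/
theorem AdelicCurveDatum.trivialModel_ansatz_univ :
    AdelicCurveDatum.trivialModel.adelicAnsatz = Set.univ := by
  ext z
  simp only [Set.mem_univ, iff_true]
  exact ⟨fun w hw => absurd (Set.mem_univ w) hw, fun w _ => Set.mem_univ _⟩

/-- The valuation-scaling claim holds in the one-point model (`1 = 1 ^ j²`), via `valuationScaling_of`. -/
theorem AdelicCurveDatum.trivialModel_valuationScaling :
    AdelicCurveDatum.trivialModel.ValuationScaling :=
  AdelicCurveDatum.trivialModel.valuationScaling_of (fun _ _ _ _ _ => by simp [AdelicCurveDatum.trivialModel])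

end Summit.ABC.IUTFork.Joshi

end
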